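import Literature.NumberTheory.Transcendental.ZilberProp112Corollaries
import Literature.NumberTheory.Transcendental.ZilberGenericClosednessProofs
import HarnessLib

/-!
# Discharge of `BaysKirby2018_saturation_of_isExpAlgClosed` (Bays–Kirby 2018, Props 11.5 + 11.2)

The named fact `Literature.NumberTheory.Transcendental.BaysKirby2018_saturation_of_isExpAlgClosed`
(`ZilberSaturation.lean`; M. Bays, J. Kirby, *Pseudo-exponential maps, variants, and
quasiminimality*, Algebra & Number Theory 12 (2018) 493–549, Prop. 11.5 + Prop. 11.2 with
Def. 5.14, applied as in the proof of Cor. 11.7: a full, exponentially-algebraically closed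
exponential field `F` is `ℵ₀`-saturated for Γ-algebraic extensions which are purely
Γ-transcendental over any countable Γ-closed `K ◁_cl F`, `K ≠ F`) **holds**, in every universe.

The tree contains the whole of Bays–Kirby's proof:

* `BaysKirby2018_saturation_of_isExpAlgClosed_of_prop_11_5` (`ZilberProp112Corollaries.lean`):
  the fact follows from Prop. 11.5 (`BaysKirby2018_prop_11_5`, GΓC ⟹ GSΓC over `K`) — this uses
  "Γ-closed ⟹ GΓC over `K`" (Cor. 11.7, proof; Zariski density of Γ-points,
  `BaysKirby2018_gammaPoints_dense_of_isExpAlgClosed_holds`, `GammaPointsDense.lean`) and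
  Prop. 11.2 (GSΓC ⟺ `ℵ₀`-saturation, `BaysKirby2018_prop_11_2_holds`, `ZilberProp112.lean`);
* `BaysKirby2018_prop_11_5_holds` (`ZilberGenericClosednessProofs.lean`): Prop. 11.5, from its
  reduction to the horizontal semiabelian weak Zilber–Pink bound for linear slices
  (`BaysKirby2018_prop_11_5_of_weakZP`, `ZilberProp115.lean`), that bound over `ℂ`
  (`WeakZP.weakZPBound_complex`, `WeakZPStar.lean`: Thm 11.4 by Ax–Schanuel, ultraproduct
  compactness and induction for the clause `(*)`) and its Lefschetz transfer to every
  algebraically closed field of characteristic zero (`weakZPBound_of_isAlgClosed`).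

This file records the resulting unconditional theorem
`BaysKirby2018_saturation_of_isExpAlgClosed_holds`. (It is a sibling of `ZilberSaturation.lean`
rather than an addition to it because `ZilberGenericClosedness.lean` imports
`ZilberSaturation.lean`.)

## References

* M. Bays, J. Kirby, *Pseudo-exponential maps, variants, and quasiminimality*, Algebra & Number
  Theory 12 (2018) 493–549 (arXiv:1512.04262): Def. 5.14, Prop. 11.2, Thm 11.4, Prop. 11.5,
  Cor. 11.7 (proof).
-/

namespace Literature.NumberTheory.Transcendental

universe u

/-- **Bays–Kirby 2018, Prop. 11.5 + Prop. 11.2 (with Def. 5.14), applied as in the proof of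
Cor. 11.7 — the named fact `BaysKirby2018_saturation_of_isExpAlgClosed` holds** (every universe):
a full Γ-field `F` (algebraically closed, `exp` onto `Fˣ`) which is Γ-closed
(= exponentially-algebraically closed) is `ℵ₀`-saturated for Γ-algebraic extensions which are
purely Γ-transcendental over every countable Γ-closed `K ◁_cl F` with `K ≠ F`, in the instance
form of `ZilberSaturation.lean`. Proof: `BaysKirby2018_saturation_of_isExpAlgClosed_of_prop_11_5`
(Γ-closed ⟹ GΓC by density of Γ-points; Prop. 11.2, proved) applied to
`BaysKirby2018_prop_11_5_holds` (Prop. 11.5: GΓC ⟹ GSΓC, via the weak Zilber–Pink theorem 11.4,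
proved over `ℂ` and transferred to all algebraically closed fields of characteristic zero).
[cite: BaysKirby2018ANT, Prop. 11.2, Prop. 11.5, Def. 5.14, Cor. 11.7 (proof)] -/
theorem BaysKirby2018_saturation_of_isExpAlgClosed_holds :
    BaysKirby2018_saturation_of_isExpAlgClosed.{u} :=
  BaysKirby2018_saturation_of_isExpAlgClosed_of_prop_11_5 BaysKirby2018_prop_11_5_holds

end Literature.NumberTheory.Transcendental
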